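import Summits.Parity.GeneralizedHardyLittlewood.Theorems.PsiGradedTablesClosePoly.Negative.MixedWrapThreshold
import Summits.Parity.GeneralizedHardyLittlewood.Theorems.PsiGradedTablesClosePoly.Negative.DetClosesOn
import HarnessLib

/-!
# The exact THREE-constant wrap region ON a class: `c₀₁² + c₁₂² + c₀₂² + 2c₀₁c₁₂c₀₂ ≤ 1`

Supports `Summit.Parity.GeneralizedHardyLittlewood.Theses.ZDegreeToeplitzBand.PsiGradedTablesClosePoly` (stmt-Parity-22438) on the
NEGATIVE lane: pure (A)-free algebra on the graded main-term matrix plus Zhang's `𝔅 ≥ 0`; no Theses statement asserted, no new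
`Prop`, standard axioms.

`MixedWrapThreshold.not_gradedClosesOn_of_cells_le_mixed` (p592711) reads a wrap display with TWO constants (`c₁` on both degree-1
tables, `c₂` on the degree-2 table). A display of (U) + O7 gives THREE constants — `c₀₁` on `x₁(f,g₁)`, `c₁₂` on `y₁(g₁,g₂)`, `c₀₂` on
`x₂(f,g₂)` — and the exact worst-phase region is the classical one for the matrix `[[1,−c₀₁,−c₀₂],[−c₀₁,1,−c₁₂],[−c₀₂,−c₁₂,1]]`:
PSD iff `c₀₁, c₁₂ ≤ 1` and `det = 1 − c₀₁² − c₁₂² − c₀₂² − 2c₀₁c₁₂c₀₂ ≥ 0`.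

* `not_gradedClosesOn_of_cells_le_three` — **inside the region there is no closing on the class** (Schur complement in the middle
  amplitude + AM–GM on the residual binary form, whose discriminant is exactly the determinant);
* `alignedTriple_det` / `gradedClosesOn_alignedTriple_by_det` — **outside it the aligned real design with equal side tables closes**,
  by the determinant certificate `DetClosesOn.gradedClosesOn_of_det_neg` (`det = B³·(1 − c₀₁² − c₁₂² − c₀₂² − 2c₀₁c₁₂c₀₂)`), so the
  region is sharp on its whole boundary. `c₀₁ = c₁₂ = c₁`, `c₀₂ = c₂` factors as `(1 − 2c₁² − c₂)(1 + c₂)`: the parabola of p592711.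
-/

noncomputable section

open Complex Real ComplexConjugate Matrix

namespace Summit.Parity.GeneralizedHardyLittlewood.Theorems.PsiGradedTablesClosePoly.Negative

open Literature.NumberTheory.LFunctions.Zhang2022 Literature.NumberTheory.LFunctions.Zhang2022.KnifeEdge
open Literature.NumberTheory.LFunctions.Zhang2022.Repair

/-! ### Part 1 — the real core -/

/-- A binary form `A·a² − 2B·a·b + C·b²` with `A, C ≥ 0`, `B ≥ 0`, `B² ≤ AC` is non-negative for `a, b ≥ 0`
(`2B·ab ≤ 2√(AC)·ab ≤ A a² + C b²`). [folklore] -/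
theorem binary_form_nonneg {A B C a b : ℝ} (hA : 0 ≤ A) (hC : 0 ≤ C) (hB : 0 ≤ B) (hdisc : B ^ 2 ≤ A * C)
    (ha : 0 ≤ a) (hb : 0 ≤ b) : 0 ≤ A * a ^ 2 - 2 * B * a * b + C * b ^ 2 := by
  have hBle : B ≤ Real.sqrt A * Real.sqrt C := by
    have h1 : Real.sqrt (B ^ 2) ≤ Real.sqrt (A * C) := Real.sqrt_le_sqrt hdisc
    rwa [Real.sqrt_sq hB, Real.sqrt_mul hA] at h1
  have hab : 0 ≤ a * b := mul_nonneg ha hb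
  have hsA := Real.sq_sqrt hA
  have hsC := Real.sq_sqrt hC
  nlinarith [sq_nonneg (Real.sqrt A * a - Real.sqrt C * b), mul_le_mul_of_nonneg_right hBle hab,
    Real.sqrt_nonneg A, Real.sqrt_nonneg C]

/-- The real quadratic `a₀² + a₁² + a₂² − 2c₀₁a₀a₁ − 2c₁₂a₁a₂ − 2c₀₂a₀a₂` is non-negative for `a₀, a₂ ≥ 0` when
`0 ≤ c₀₁ ≤ 1`, `0 ≤ c₁₂ ≤ 1`, `0 ≤ c₀₂` and `c₀₁² + c₁₂² + c₀₂² + 2c₀₁c₁₂c₀₂ ≤ 1`: complete the square in `a₁`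
(`(a₁ − c₀₁a₀ − c₁₂a₂)²`) and apply `binary_form_nonneg` to the residual `(1−c₀₁²)a₀² − 2(c₀₂ + c₀₁c₁₂)a₀a₂ + (1−c₁₂²)a₂²`,
whose discriminant condition is exactly the determinant condition. [folklore] -/
theorem three_real_form_nonneg {c₀₁ c₁₂ c₀₂ a₀ a₁ a₂ : ℝ} (h₀₁ : 0 ≤ c₀₁) (h₀₁' : c₀₁ ≤ 1) (h₁₂ : 0 ≤ c₁₂) (h₁₂' : c₁₂ ≤ 1)
    (h₀₂ : 0 ≤ c₀₂) (hdet : c₀₁ ^ 2 + c₁₂ ^ 2 + c₀₂ ^ 2 + 2 * c₀₁ * c₁₂ * c₀₂ ≤ 1) (ha₀ : 0 ≤ a₀) (ha₂ : 0 ≤ a₂) :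
    0 ≤ a₀ ^ 2 + a₁ ^ 2 + a₂ ^ 2 - 2 * c₀₁ * a₀ * a₁ - 2 * c₁₂ * a₁ * a₂ - 2 * c₀₂ * a₀ * a₂ := by
  have hA : 0 ≤ 1 - c₀₁ ^ 2 := by nlinarith
  have hC : 0 ≤ 1 - c₁₂ ^ 2 := by nlinarith
  have hB : 0 ≤ c₀₂ + c₀₁ * c₁₂ := by positivity
  have hdisc : (c₀₂ + c₀₁ * c₁₂) ^ 2 ≤ (1 - c₀₁ ^ 2) * (1 - c₁₂ ^ 2) := by nlinarith
  have hres := binary_form_nonneg hA hC hB hdisc ha₀ ha₂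
  nlinarith [sq_nonneg (a₁ - c₀₁ * a₀ - c₁₂ * a₂)]

variable {X₁ Y₁ X₂ : PairFunctional} {f f' g₁ g₁' g₂ g₂' : ℝ → ℂ} {𝒞 : PairClass}

/-- **Three-constant scaled Gershgorin (proved, (A)-free):** at a design with diagonal forms `≥ 0` and cells
`‖X₁‖² ≤ c₀₁²·𝔅(f)𝔅(g₁)`, `‖Y₁‖² ≤ c₁₂²·𝔅(g₁)𝔅(g₂)`, `‖X₂‖² ≤ c₀₂²·𝔅(f)𝔅(g₂)` with the constants in the region
`0 ≤ c₀₁, c₁₂ ≤ 1`, `0 ≤ c₀₂`, `c₀₁² + c₁₂² + c₀₂² + 2c₀₁c₁₂c₀₂ ≤ 1`, the graded form is non-negative at every amplitude vector.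
[cite: Zhang2022LandauSiegel, §2 (2.16)–(2.17)] -/
theorem gradedQuadForm_nonneg_of_cells_le_three {c₀₁ c₁₂ c₀₂ : ℝ} (h₀₁ : 0 ≤ c₀₁) (h₀₁' : c₀₁ ≤ 1) (h₁₂ : 0 ≤ c₁₂)
    (h₁₂' : c₁₂ ≤ 1) (h₀₂ : 0 ≤ c₀₂) (hdet : c₀₁ ^ 2 + c₁₂ ^ 2 + c₀₂ ^ 2 + 2 * c₀₁ * c₁₂ * c₀₂ ≤ 1)
    (hB0 : 0 ≤ mainTermForm f f') (hB1 : 0 ≤ mainTermForm g₁ g₁') (hB2 : 0 ≤ mainTermForm g₂ g₂')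
    (h01 : ‖X₁ f f' g₁ g₁'‖ ^ 2 ≤ c₀₁ ^ 2 * (mainTermForm f f' * mainTermForm g₁ g₁'))
    (h12 : ‖Y₁ g₁ g₁' g₂ g₂'‖ ^ 2 ≤ c₁₂ ^ 2 * (mainTermForm g₁ g₁' * mainTermForm g₂ g₂'))
    (h02 : ‖X₂ f f' g₂ g₂'‖ ^ 2 ≤ c₀₂ ^ 2 * (mainTermForm f f' * mainTermForm g₂ g₂')) (s : Fin 3 → ℂ) :
    0 ≤ gradedQuadForm (gradedMainMatrix X₁ Y₁ X₂ f f' g₁ g₁' g₂ g₂') s := by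
  rw [gradedQuadForm_eq]
  set a₀ := Real.sqrt (mainTermForm f f') * ‖s 0‖ with ha₀
  set a₁ := Real.sqrt (mainTermForm g₁ g₁') * ‖s 1‖ with ha₁
  set a₂ := Real.sqrt (mainTermForm g₂ g₂') * ‖s 2‖ with ha₂
  have e₀ : mainTermForm f f' * ‖s 0‖ ^ 2 = a₀ ^ 2 := by rw [ha₀, mul_pow, Real.sq_sqrt hB0]
  have e₁ : mainTermForm g₁ g₁' * ‖s 1‖ ^ 2 = a₁ ^ 2 := by rw [ha₁, mul_pow, Real.sq_sqrt hB1]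
  have e₂ : mainTermForm g₂ g₂' * ‖s 2‖ ^ 2 = a₂ ^ 2 := by rw [ha₂, mul_pow, Real.sq_sqrt hB2]
  have k01 := two_re_cross_ge_const (s 0) (s 1) (X₁ f f' g₁ g₁') hB0 hB1 h₀₁ h01
  have k12 := two_re_cross_ge_const (s 1) (s 2) (Y₁ g₁ g₁' g₂ g₂') hB1 hB2 h₁₂ h12
  have k02 := two_re_cross_ge_const (s 0) (s 2) (X₂ f f' g₂ g₂') hB0 hB2 h₀₂ h02
  have core := three_real_form_nonneg (a₁ := a₁) h₀₁ h₀₁' h₁₂ h₁₂' h₀₂ hdet (by positivity : 0 ≤ a₀) (by positivity : 0 ≤ a₂)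
  rw [e₀, e₁, e₂]
  rw [← ha₀, ← ha₁] at k01
  rw [← ha₁, ← ha₂] at k12
  rw [← ha₀, ← ha₂] at k02
  linarith

/-! ### Part 2 — inside the region: no closing ON the class -/

/-- **THREE-CONSTANT WRAP BOUND ⇒ NO CLOSING ON THE CLASS (proved, (A)-free):** if on every in-class pair of `𝒞`
`‖X₁(u,v)‖² ≤ c₀₁²·𝔅(u)𝔅(v)`, `‖Y₁(u,v)‖² ≤ c₁₂²·𝔅(u)𝔅(v)`, `‖X₂(u,v)‖² ≤ c₀₂²·𝔅(u)𝔅(v)` with `0 ≤ c₀₁, c₁₂ ≤ 1`, `0 ≤ c₀₂` and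
**`c₀₁² + c₁₂² + c₀₂² + 2c₀₁c₁₂c₀₂ ≤ 1`**, then `¬ GradedClosesOn 𝒞 X₁ Y₁ X₂`. (`c₀₁ = c₁₂ = c₁`, `c₀₂ = c₂` is the parabola
`c₂ ≤ 1 − 2c₁²` of `not_gradedClosesOn_of_cells_le_mixed`; all three `½` is `not_gradedClosesOn_of_cells_le_half_geom`.)
[cite: Zhang2022LandauSiegel, §2 (2.16)–(2.17), §7 Prop 7.1 (7.2)] -/
theorem not_gradedClosesOn_of_cells_le_three {c₀₁ c₁₂ c₀₂ : ℝ} (h₀₁ : 0 ≤ c₀₁) (h₀₁' : c₀₁ ≤ 1) (h₁₂ : 0 ≤ c₁₂)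
    (h₁₂' : c₁₂ ≤ 1) (h₀₂ : 0 ≤ c₀₂) (hdet : c₀₁ ^ 2 + c₁₂ ^ 2 + c₀₂ ^ 2 + 2 * c₀₁ * c₁₂ * c₀₂ ≤ 1)
    (hX₁ : ∀ u u' v v', InClassPiece u u' → InClassPiece v v' → 𝒞 u u' v v' →
      ‖X₁ u u' v v'‖ ^ 2 ≤ c₀₁ ^ 2 * (mainTermForm u u' * mainTermForm v v'))
    (hY₁ : ∀ u u' v v', InClassPiece u u' → InClassPiece v v' → 𝒞 u u' v v' →
      ‖Y₁ u u' v v'‖ ^ 2 ≤ c₁₂ ^ 2 * (mainTermForm u u' * mainTermForm v v'))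
    (hX₂ : ∀ u u' v v', InClassPiece u u' → InClassPiece v v' → 𝒞 u u' v v' →
      ‖X₂ u u' v v'‖ ^ 2 ≤ c₀₂ ^ 2 * (mainTermForm u u' * mainTermForm v v')) :
    ¬ GradedClosesOn 𝒞 X₁ Y₁ X₂ := by
  rintro ⟨f, f', g₁, g₁', g₂, g₂', s, hf, hg₁, hg₂, h01, h02, h12, hneg⟩
  have hB0 := mainTermForm_nonneg_of_isH1 hf.kinked.isH1
  have hB1 := mainTermForm_nonneg_of_isH1 hg₁.kinked.isH1
  have hB2 := mainTermForm_nonneg_of_isH1 hg₂.kinked.isH1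
  have := gradedQuadForm_nonneg_of_cells_le_three h₀₁ h₀₁' h₁₂ h₁₂' h₀₂ hdet hB0 hB1 hB2 (hX₁ _ _ _ _ hf hg₁ h01)
    (hY₁ _ _ _ _ hg₁ hg₂ h12) (hX₂ _ _ _ _ hf hg₂ h02) s
  linarith

/-! ### Part 3 — outside the region: the aligned design closes by the determinant (sharpness on the whole boundary) -/

section AlignedTriple

variable {B c₀₁ c₁₂ c₀₂ : ℝ}

/-- **The determinant of the aligned triple (pure algebra):** with `𝔅(f) = 𝔅(g₁) = 𝔅(g₂) = B` and real aligned cells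
`X₁(f,g₁) = −c₀₁B`, `Y₁(g₁,g₂) = −c₁₂B`, `X₂(f,g₂) = −c₀₂B`, `det = B³·(1 − c₀₁² − c₁₂² − c₀₂² − 2c₀₁c₁₂c₀₂)`. [folklore] -/
theorem alignedTriple_det (hBf : mainTermForm f f' = B) (hB1 : mainTermForm g₁ g₁' = B) (hB2 : mainTermForm g₂ g₂' = B)
    (hX₁ : X₁ f f' g₁ g₁' = -((c₀₁ * B : ℝ) : ℂ)) (hY₁ : Y₁ g₁ g₁' g₂ g₂' = -((c₁₂ * B : ℝ) : ℂ))
    (hX₂ : X₂ f f' g₂ g₂' = -((c₀₂ * B : ℝ) : ℂ)) :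
    (gradedMainMatrix X₁ Y₁ X₂ f f' g₁ g₁' g₂ g₂').det
      = ((B ^ 3 * (1 - c₀₁ ^ 2 - c₁₂ ^ 2 - c₀₂ ^ 2 - 2 * c₀₁ * c₁₂ * c₀₂) : ℝ) : ℂ) := by
  rw [Matrix.det_fin_three]
  simp only [gradedMainMatrix, hBf, hB1, hB2, hX₁, hY₁, hX₂, map_neg, Complex.conj_ofReal, Matrix.of_apply,
    Matrix.cons_val', Matrix.cons_val_zero, Matrix.cons_val_one, Matrix.cons_val_two, Matrix.empty_val',
    Matrix.cons_val_fin_one, Matrix.head_cons, Matrix.tail_cons, Matrix.head_fin_const]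
  push_cast
  ring

/-- **OUTSIDE THE REGION THE ALIGNED DESIGN CLOSES ON THE CLASS (proved):** in-class pieces with the three pairs in `𝒞`, equal
side tables `B > 0`, aligned real cells `−c₀₁B, −c₁₂B, −c₀₂B` and `1 < c₀₁² + c₁₂² + c₀₂² + 2c₀₁c₁₂c₀₂` give `GradedClosesOn 𝒞 X₁ Y₁ X₂`
by the determinant certificate (`Re det = B³·(1 − Σc² − 2Πc) < 0`). With `MixedWrapThreshold.norm_sq_alignedCell` the design sits
exactly on the hypotheses of `not_gradedClosesOn_of_cells_le_three`, so that region cannot be enlarged.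
[cite: Zhang2022LandauSiegel, §2 (2.16)–(2.17), §7 Prop 7.1 (7.2)] -/
theorem gradedClosesOn_alignedTriple_by_det (hf : InClassPiece f f') (hg₁ : InClassPiece g₁ g₁') (hg₂ : InClassPiece g₂ g₂')
    (h01 : 𝒞 f f' g₁ g₁') (h02 : 𝒞 f f' g₂ g₂') (h12 : 𝒞 g₁ g₁' g₂ g₂')
    (hBf : mainTermForm f f' = B) (hB1 : mainTermForm g₁ g₁' = B) (hB2 : mainTermForm g₂ g₂' = B)
    (hX₁ : X₁ f f' g₁ g₁' = -((c₀₁ * B : ℝ) : ℂ)) (hY₁ : Y₁ g₁ g₁' g₂ g₂' = -((c₁₂ * B : ℝ) : ℂ))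
    (hX₂ : X₂ f f' g₂ g₂' = -((c₀₂ * B : ℝ) : ℂ)) (hB : 0 < B)
    (hout : 1 < c₀₁ ^ 2 + c₁₂ ^ 2 + c₀₂ ^ 2 + 2 * c₀₁ * c₁₂ * c₀₂) : GradedClosesOn 𝒞 X₁ Y₁ X₂ := by
  refine gradedClosesOn_of_det_neg hf hg₁ hg₂ h01 h02 h12 ?_
  rw [alignedTriple_det hBf hB1 hB2 hX₁ hY₁ hX₂, Complex.ofReal_re]
  have hB3 : 0 < B ^ 3 := by positivity
  nlinarith [mul_pos hB3 (sub_pos.mpr hout)]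

end AlignedTriple

end Summit.Parity.GeneralizedHardyLittlewood.Theorems.PsiGradedTablesClosePoly.Negative

end
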